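import Literature.Analysis.FluidPDE.TorusWordSobolev
import Literature.Analysis.FunctionSpaces.TorusLowOrderLeibniz
import HarnessLib

/-!
# Word derivatives on the flat torus, II: linearity and the Leibniz formula along words

Analysis/FluidPDE support file (everything proved; no named facts), sequel of `TorusWordSobolev`
(which defines `Torus.wordDeriv` and proves its Plancherel bounds). Energy estimates of
arbitrary order `s` for quasilinear systems on `𝕋^d` (Majda 1984, Ch. 2, Thm 2.2: propagation of
`H^s` regularity for every `s`; Majda–Bertozzi 2002, Prop. 3.7) are organised by DERIVATIVE WORDS
`w = [i₁, …, iₙ]`, `∂^w = ∂_{i₁} ⋯ ∂_{iₙ}`. This file continues the word calculus of the tree's `Torus.wordDeriv`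
(`∂^w f`, outermost letter first; `isSmooth_wordDeriv`):

* `wordDeriv_append`, linearity (`wordDeriv_add/sub/neg/const_smul/zero`, `List` sums);
* `splits w` — the `2^{|w|}` ordered splittings of `w` into two complementary subwords, with
  `length_splits`, `mem_splits_length`;
* the **Leibniz formula along words** `wordDeriv_mul`, `wordDeriv_smul`:
  `∂^w(fg) = ∑_{(a,b) ∈ splits w} ∂^a f · ∂^b g`, and the pointwise bound `norm_wordDeriv_smul_le`.

## References

* A. Majda, *Compressible Fluid Flow and Systems of Conservation Laws in Several Space
  Variables*, Springer 1984, Ch. 2 §2.1 (multi-index calculus behind Prop. 2.1–2.2). [`Majda1984`]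
-/

noncomputable section

open Set Function
open scoped ContDiff

namespace Literature.Analysis.FluidPDE

namespace Torus

open FunctionSpaces FunctionSpaces.Torus

variable {d : Type*} [Fintype d] [DecidableEq d] {F : Type*} [NormedAddCommGroup F] [NormedSpace ℝ F]

/-! ## Word derivatives: complements -/

omit [Fintype d] in
/-- `∂^{[i]} f = ∂ᵢ f`. [folklore] -/
theorem wordDeriv_singleton (i : d) (f : UnitAddTorus d → F) : wordDeriv [i] f = Torus.partialDeriv i f := rfl

omit [Fintype d] in
/-- `∂^{v ++ w} f = ∂^v (∂^w f)`. [folklore] -/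
theorem wordDeriv_append (v w : List d) (f : UnitAddTorus d → F) :
    wordDeriv (v ++ w) f = wordDeriv v (wordDeriv w f) := by
  induction v with
  | nil => rfl
  | cons i v ih => simp [ih]

omit [Fintype d] in
/-- `∂^{w ++ [i]} f = ∂^w (∂ᵢ f)` (innermost letter last). [folklore] -/
theorem wordDeriv_concat (w : List d) (i : d) (f : UnitAddTorus d → F) :
    wordDeriv (w ++ [i]) f = wordDeriv w (Torus.partialDeriv i f) := by
  rw [wordDeriv_append]; rfl

/-! ## Linearity -/

omit [Fintype d] in
/-- `∂^w 0 = 0`. [folklore] -/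
theorem wordDeriv_zero : ∀ w : List d, wordDeriv w (fun _ : UnitAddTorus d => (0 : F)) = fun _ => 0
  | [] => rfl
  | i :: w => by
      rw [wordDeriv_cons, wordDeriv_zero w]
      funext x
      simp [Torus.partialDeriv, Torus.lineDeriv]

/-- `∂^w (c • f) = c • ∂^w f` for smooth `f`. [folklore] -/
theorem wordDeriv_const_smul {f : UnitAddTorus d → F} (hf : IsSmooth f) (c : ℝ) :
    ∀ w : List d, wordDeriv w (c • f) = c • wordDeriv w f
  | [] => rfl
  | i :: w => by
      rw [wordDeriv_cons, wordDeriv_cons, wordDeriv_const_smul hf c w,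
        partialDeriv_const_smul ((isSmooth_wordDeriv hf w).isContDiff (by simp)) c i]

/-- `∂^w (f + g) = ∂^w f + ∂^w g` for smooth `f, g`. [folklore] -/
theorem wordDeriv_add {f g : UnitAddTorus d → F} (hf : IsSmooth f) (hg : IsSmooth g) :
    ∀ w : List d, wordDeriv w (f + g) = wordDeriv w f + wordDeriv w g
  | [] => rfl
  | i :: w => by
      rw [wordDeriv_cons, wordDeriv_cons, wordDeriv_cons, wordDeriv_add hf hg w,
        partialDeriv_add ((isSmooth_wordDeriv hf w).isContDiff (by simp)) ((isSmooth_wordDeriv hg w).isContDiff (by simp))]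

/-- `∂^w (-f) = -∂^w f` for smooth `f`. [folklore] -/
theorem wordDeriv_neg {f : UnitAddTorus d → F} (hf : IsSmooth f) (w : List d) : wordDeriv w (-f) = -wordDeriv w f := by
  have h := wordDeriv_const_smul hf (-1) w
  simp only [neg_one_smul] at h
  exact h

/-- `∂^w (f - g) = ∂^w f - ∂^w g` for smooth `f, g`. [folklore] -/
theorem wordDeriv_sub {f g : UnitAddTorus d → F} (hf : IsSmooth f) (hg : IsSmooth g) (w : List d) :
    wordDeriv w (f - g) = wordDeriv w f - wordDeriv w g := by
  rw [sub_eq_add_neg, wordDeriv_add hf hg.neg, wordDeriv_neg hg, sub_eq_add_neg]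

omit [Fintype d] in
/-- `∂^w` of a constant vanishes for nonempty words. [folklore] -/
theorem wordDeriv_const_of_ne_nil (c : F) : ∀ {w : List d}, w ≠ [] → wordDeriv w (fun _ : UnitAddTorus d => c) = fun _ => 0
  | [], h => (h rfl).elim
  | i :: w, _ => by
      rw [wordDeriv_cons]
      by_cases hw : w = []
      · subst hw
        funext x
        simp [Torus.partialDeriv, Torus.lineDeriv]
      · rw [wordDeriv_const_of_ne_nil c hw]
        funext x
        simp [Torus.partialDeriv, Torus.lineDeriv]

omit [DecidableEq d] in
/-- Smoothness of `List` sums of smooth functions. [folklore] -/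
theorem isSmooth_list_sum {ι : Type*} (l : List ι) {g : ι → UnitAddTorus d → F} (hg : ∀ a ∈ l, IsSmooth (g a)) :
    IsSmooth (l.map g).sum := by
  induction l with
  | nil => exact isSmooth_const (0 : F)
  | cons b l ih =>
      rw [List.map_cons, List.sum_cons]
      exact (hg b (by simp)).add (ih fun c hc => hg c (List.mem_cons_of_mem b hc))

/-- `∂^w` of a finite sum of smooth functions (as a `List` sum). [folklore] -/
theorem wordDeriv_list_sum {ι : Type*} (l : List ι) {g : ι → UnitAddTorus d → F} (hg : ∀ a ∈ l, IsSmooth (g a))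
    (w : List d) : wordDeriv w (l.map g).sum = (l.map fun a => wordDeriv w (g a)).sum := by
  induction l with
  | nil => exact wordDeriv_zero (F := F) w
  | cons a l ih =>
      have ha : IsSmooth (g a) := hg a (by simp)
      have hl : ∀ b ∈ l, IsSmooth (g b) := fun b hb => hg b (List.mem_cons_of_mem a hb)
      rw [List.map_cons, List.sum_cons, List.map_cons, List.sum_cons, wordDeriv_add ha (isSmooth_list_sum l hl) w, ih hl]

omit [Fintype d] [DecidableEq d] [NormedSpace ℝ F] in
/-- Norms of `List` sums. [folklore] -/
theorem norm_list_sum_le (l : List F) : ‖l.sum‖ ≤ (l.map fun a => ‖a‖).sum := by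
  induction l with
  | nil => simp
  | cons a l ih =>
      rw [List.sum_cons, List.map_cons, List.sum_cons]
      exact (norm_add_le _ _).trans (by linarith)

/-! ## Splittings of a word and the Leibniz formula -/

/-- The `2^{|w|}` ordered splittings of `w` into two complementary subwords. [folklore] -/
def splits : List d → List (List d × List d)
  | [] => [([], [])]
  | i :: w => (splits w).flatMap fun p => [(i :: p.1, p.2), (p.1, i :: p.2)]

omit [Fintype d] [DecidableEq d] in
/-- The only splitting of the empty word. [folklore] -/
@[simp] theorem splits_nil : splits ([] : List d) = [([], [])] := rfl

omit [Fintype d] [DecidableEq d] in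
/-- Splittings of `i :: w`: put `i` in the first or in the second part of a splitting of `w`. [folklore] -/
theorem splits_cons (i : d) (w : List d) :
    splits (i :: w) = (splits w).flatMap fun p => [(i :: p.1, p.2), (p.1, i :: p.2)] := rfl

omit [Fintype d] [DecidableEq d] in
/-- There are `2^{|w|}` splittings. [folklore] -/
theorem length_splits : ∀ w : List d, (splits w).length = 2 ^ w.length
  | [] => rfl
  | i :: w => by
      rw [splits_cons, List.length_flatMap, List.length_cons, pow_succ]
      simp [length_splits w, List.sum_replicate, mul_comm]

omit [Fintype d] [DecidableEq d] in
/-- The two parts of a splitting have complementary lengths. [folklore] -/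
theorem mem_splits_length : ∀ {w : List d} {p : List d × List d}, p ∈ splits w → p.1.length + p.2.length = w.length
  | [], p, hp => by
      simp only [splits_nil, List.mem_singleton] at hp
      subst hp; rfl
  | i :: w, p, hp => by
      simp only [splits_cons, List.mem_flatMap, List.mem_cons, List.mem_nil_iff, or_false] at hp
      obtain ⟨q, hq, h | h⟩ := hp
      · subst h
        have := mem_splits_length hq
        simp only [List.length_cons]; omega
      · subst h
        have := mem_splits_length hq
        simp only [List.length_cons]; omega

omit [Fintype d] [DecidableEq d] in
/-- Both parts of a splitting are at most as long as the word. [folklore] -/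
theorem mem_splits_length_le {w : List d} {p : List d × List d} (hp : p ∈ splits w) :
    p.1.length ≤ w.length ∧ p.2.length ≤ w.length := by
  have h := mem_splits_length hp
  omega

/-- **Leibniz formula along words** (scalar times vector): for smooth `f : 𝕋^d → ℝ`, `g : 𝕋^d → F`,
`∂^w (f • g) = ∑_{(a,b) ∈ splits w} ∂^a f • ∂^b g`. [folklore] -/
theorem wordDeriv_smul {f : UnitAddTorus d → ℝ} {g : UnitAddTorus d → F} (hf : IsSmooth f) (hg : IsSmooth g) :
    ∀ w : List d, wordDeriv w (fun x => f x • g x) =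
      ((splits w).map fun p => fun x => wordDeriv p.1 f x • wordDeriv p.2 g x).sum
  | [] => by simp
  | i :: w => by
      rw [wordDeriv_cons, wordDeriv_smul hf hg w]
      have hsm : ∀ p ∈ splits w, IsSmooth (fun x => wordDeriv p.1 f x • wordDeriv p.2 g x) := fun p _ =>
        (isSmooth_wordDeriv hf p.1).smul' (isSmooth_wordDeriv hg p.2)
      -- `∂ᵢ` through the list sum
      have h1 : Torus.partialDeriv i ((splits w).map fun p => fun x => wordDeriv p.1 f x • wordDeriv p.2 g x).sum =
          ((splits w).map fun p => Torus.partialDeriv i (fun x => wordDeriv p.1 f x • wordDeriv p.2 g x)).sum := by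
        have := wordDeriv_list_sum (splits w) (g := fun p => fun x => wordDeriv p.1 f x • wordDeriv p.2 g x) hsm [i]
        simpa [wordDeriv_singleton] using this
      rw [h1, splits_cons]
      -- termwise product rule
      induction splits w with
      | nil => simp
      | cons p l ih =>
          have hsm' : ∀ q ∈ l, IsSmooth (fun x => wordDeriv q.1 f x • wordDeriv q.2 g x) := fun q hq =>
            (isSmooth_wordDeriv hf q.1).smul' (isSmooth_wordDeriv hg q.2)
          rw [List.map_cons, List.sum_cons, List.flatMap_cons, List.map_append, List.sum_append, ih]
          congr 1
          have e := partialDeriv_smul ((isSmooth_wordDeriv hf p.1).isContDiff (n := 1) (by simp))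
            ((isSmooth_wordDeriv hg p.2).isContDiff (n := 1) (by simp)) i
          simp only [List.map_cons, List.map_nil, List.sum_cons, List.sum_nil, add_zero, wordDeriv_cons]
          funext x
          rw [e x, add_comm, Pi.add_apply]

/-- **Leibniz formula along words** (scalar product): for smooth `f, g : 𝕋^d → ℝ`,
`∂^w (f g) = ∑_{(a,b) ∈ splits w} ∂^a f · ∂^b g`. [folklore] -/
theorem wordDeriv_mul {f g : UnitAddTorus d → ℝ} (hf : IsSmooth f) (hg : IsSmooth g) (w : List d) :
    wordDeriv w (fun x => f x * g x) = ((splits w).map fun p => fun x => wordDeriv p.1 f x * wordDeriv p.2 g x).sum := by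
  have h := wordDeriv_smul hf hg w
  simpa only [smul_eq_mul] using h

omit [Fintype d] [DecidableEq d] [NormedSpace ℝ F] in
/-- Evaluating a `List` sum of functions. [folklore] -/
theorem list_sum_apply {ι : Type*} (l : List ι) (g : ι → UnitAddTorus d → F) (x : UnitAddTorus d) :
    (l.map g).sum x = (l.map fun a => g a x).sum := by
  induction l with
  | nil => rfl
  | cons a l ih => simp [ih]

/-- **Pointwise bound for the Leibniz expansion**:
`‖∂^w(f • g)(x)‖ ≤ ∑_{(a,b) ∈ splits w} |∂^a f(x)| ‖∂^b g(x)‖`. [folklore] -/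
theorem norm_wordDeriv_smul_le {f : UnitAddTorus d → ℝ} {g : UnitAddTorus d → F} (hf : IsSmooth f) (hg : IsSmooth g)
    (w : List d) (x : UnitAddTorus d) :
    ‖wordDeriv w (fun y => f y • g y) x‖ ≤ ((splits w).map fun p => |wordDeriv p.1 f x| * ‖wordDeriv p.2 g x‖).sum := by
  rw [wordDeriv_smul hf hg w, list_sum_apply]
  refine (norm_list_sum_le _).trans (le_of_eq ?_)
  rw [List.map_map]
  congr 1
  refine List.map_congr_left fun p _ => ?_
  simp only [Function.comp_apply, norm_smul, Real.norm_eq_abs]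

end Torus

end Literature.Analysis.FluidPDE

end
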